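import Literature.Barriers.CriticalPhenomena.WeaklySAWFlowWeightedSpaces
import Literature.Barriers.CriticalPhenomena.WeaklySAWQuadraticFlowLipschitz
import HarnessLib

/-!
# [BBS-rg-flow, towards Theorem 1.4(ii)]: the homogeneous `g`-mode of the linearised flow and the bound
# (3.15) `‖D_{g₀}x̄‖_{X^𝗐} ≤ O(g̊₀⁻²|log g̊₀|⁻¹)` for the `𝒱`-components

File of the series formalising [BBS-rg-flow] (Bauerschmidt–Brydges–Slade, AHP 16 (2015),
arXiv:1211.2477) towards `Literature.Barriers.CriticalPhenomena.WeaklySAWFourDimLogCorrections`;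
continuation of `WeaklySAWFlowWeightedSpaces.lean` (weights (3.2), `linG/linZ/linMu`) and
`WeaklySAWQuadraticFlowLipschitz.lean` (the backward solutions `bwdZ`, `bwdMu`).

Plan for Theorem 1.4(ii) (smooth dependence of the critical flow on `g₀`): with the reference flow
`x̊ = x̄(g̊₀)` and its weights FIXED, the flow with initial condition `g₀` is the fixed point of the affine
family `T̃_{g₀}(y) = T(y) + (g₀ - g̊₀)·(0, e)`, where `e` is the scaled HOMOGENEOUS MODE of the linearised
`𝒱`-system `y_{j+1} = L_jy_j` with `g`-initial value `1` and `(z, μ)_∞ = 0`; affinity in `g₀` makes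
the differentiability of `T̃` in `(g₀, y)` that of `T` in `y`. This file constructs `e` and proves (3.15):
* `piG` (`π_j = ∏_{i<j}(1 - 2β_ig̊_i) = ∂ḡ_j/∂g₀`, `0 ≤ π_j ≤ (g̊_j/g̊₀)²`), `modeZ` (`Zᵉ = bwdZ(-ξ̃π)`, the
  `z`-row: `Zᵉ_{j+1} = (1-ζ_jg̊_j)Zᵉ_j - ξ̃_jπ_j`, `|Zᵉ_j| ≤ (K_Z/g₀²)χ_jg̊_j²`, `Zᵉ_j → 0`), `modeMu`
  (`Mᵉ = bwdMu(η̃π + γ̃Zᵉ)`, `Mᵉ_{j+1} = λ̃_jMᵉ_j + η̃_jπ_j + γ̃_jZᵉ_j`, `|Mᵉ_j| ≤ (8F'/((λ-1)g₀²))χ_jg̊_j²`,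
  `Mᵉ_j → 0`) — these are `(∂ḡ_j, ∂z̄_j, ∂μ̄_j)/∂g₀` of Lemma 2.3 ((2.35)–(2.40)), here only as the mode;
* the constants `xiTConst`, `modeZConst`, `etaTConst`, `gammaTConst`, `modeMuSrcConst`, `modeVConst`
  (depending only on `(Ω, c, N, C, λ)`), `abs_log_gbar_ge` (`|log g̊_j| ≥ |log g₀|/2`);
* `QuadFlowParams.modeV` (the scaled mode `e_j = (π_j/𝗐_{g,j}, Zᵉ_j/𝗐_{z,j}, Mᵉ_j/𝗐_{μ,j})`) and
  **`norm_modeV_le`**: `‖e_j‖ ≤ K_e/(𝗁g₀²|log g₀|)` = the bound (3.15) of Lemma 3.4.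

## References
* R. Bauerschmidt, D. C. Brydges, G. Slade, *Structural stability of a dynamical system near a
  non-hyperbolic fixed point*, Ann. Henri Poincaré 16 (2015), arXiv:1211.2477: Lemma 2.3 (2.35)–(2.40),
  Lemma 3.4 (3.15), Lemma 4.1(ii), Lemma 4.2. [BauerschmidtBrydgesSlade2015Flow]
-/

noncomputable section

open Filter Topology Set
open scoped BigOperators

namespace Literature.Barriers.CriticalPhenomena

namespace CTWSAW

/-! ## The homogeneous `g`-mode of the linearised quadratic flow: the solution `(π, Zᵉ, Mᵉ)` of
`y_{j+1} = L_jy_j` with `g`-initial value `1` and `(z, μ)_∞ = 0` — the direction `D_{g₀}x̄` of Lemma 3.4 -/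

namespace QuadFlowParams

variable (P : QuadFlowParams) (g₀ : ℝ)

/-- `π_j = ∏_{i<j} a_i = ∏_{i<j}(1 - 2β_ig̊_i)` (`= ∂ḡ_j/∂g₀`, cf. (2.35)), the `g`-row of the homogeneous
mode. [cite: BauerschmidtBrydgesSlade2015Flow, Lemma 2.3, (2.35)–(2.36) and Lemma 4.2] -/
def piG (j : ℕ) : ℝ := ∏ i ∈ Finset.range j, P.aCoef g₀ i

/-- `π₀ = 1`. [cite: BauerschmidtBrydgesSlade2015Flow, Lemma 2.3, (2.35)] -/
@[simp] theorem piG_zero : P.piG g₀ 0 = 1 := by simp [piG]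

/-- `π_{j+1} = a_jπ_j`. [cite: BauerschmidtBrydgesSlade2015Flow, Lemma 2.3, (2.35)] -/
theorem piG_succ (j : ℕ) : P.piG g₀ (j + 1) = P.aCoef g₀ j * P.piG g₀ j := by
  rw [piG, Finset.prod_range_succ, mul_comm]; rfl

/-- `Zᵉ_j`: the decaying solution of `Z_{j+1} = (1 - ζ_jg̊_j)Z_j - ξ̃_jπ_j` (the `z`-row of the
homogeneous mode, `= ∂z̄_j/∂g₀`, cf. (2.37)). [cite: BauerschmidtBrydgesSlade2015Flow, Lemma 2.3, (2.37) and Lemma 4.2, (4.11)] -/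
def modeZ (j : ℕ) : ℝ := P.bwdZ g₀ (fun l => -(P.xiT g₀ l * P.piG g₀ l)) j

/-- `Mᵉ_j`: the bounded solution of `M_{j+1} = λ̃_jM_j + η̃_jπ_j + γ̃_jZᵉ_j` (the `μ`-row of the homogeneous
mode, `= ∂μ̄_j/∂g₀`, cf. (2.39)–(2.40)). [cite: BauerschmidtBrydgesSlade2015Flow, Lemma 2.3, (2.39)–(2.40) and Lemma 4.2, (4.11)] -/
def modeMu (j : ℕ) : ℝ := P.bwdMu g₀ (fun l => P.etaT g₀ l * P.piG g₀ l + P.gammaT g₀ l * P.modeZ g₀ l) j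

/-- `∏(1 - ζg̊)⁻¹` in the two notations agree. [cite: BauerschmidtBrydgesSlade2015Flow, Lemma 4.1(iii)] -/
theorem czInvProd_eq_zetaInvProd (j l : ℕ) : P.czInvProd g₀ j l = P.zetaInvProd g₀ j l := by
  rw [P.czInvProd_eq_prod_Icc, ← P.zetaInvProd_eq_prod_Icc]

end QuadFlowParams

/-- `C_ξ = C(2+Z)`: `|ξ̃_j| ≤ C_ξχ_jg̊_j` (Lemma 4.1(ii)). [cite: BauerschmidtBrydgesSlade2015Flow, Lemma 4.1(ii), (4.7)] -/
def xiTConst (Ω c : ℝ) (N : ℕ) (C : ℝ) : ℝ := C * (2 + 2 * C * ((1 + N) / c + N + 2 * Ω / (Ω - 1)))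

/-- `K_Z = 4C_ξC_{2,0}`: `|Zᵉ_j| ≤ (K_Z/g₀²)χ_jg̊_j²`. [cite: BauerschmidtBrydgesSlade2015Flow, Lemma 2.3, (2.38)] -/
def modeZConst (Ω c : ℝ) (N : ℕ) (C : ℝ) : ℝ := 4 * xiTConst Ω c N C * ((1 + N) / c + N + 2 * Ω / (Ω - 1))

/-- `C_η`: `|η̃_j| ≤ C_ηχ_j` (Lemma 4.1(ii)). [cite: BauerschmidtBrydgesSlade2015Flow, Lemma 4.1(ii), (4.7)] -/
def etaTConst (Ω c : ℝ) (N : ℕ) (C lam : ℝ) : ℝ :=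
  C * (2 + (2 * C * ((1 + N) / c + N + 2 * Ω / (Ω - 1)) +
    4 * (C * (3 + 3 * (2 * C * ((1 + N) / c + N + 2 * Ω / (Ω - 1))) +
      (2 * C * ((1 + N) / c + N + 2 * Ω / (Ω - 1))) ^ 2) / 2) / (lam - 1)) / 2)

/-- `C_γ`: `|γ̃_j| ≤ C_γχ_j` (Lemma 4.1(ii)). [cite: BauerschmidtBrydgesSlade2015Flow, Lemma 4.1(ii), (4.7)] -/
def gammaTConst (Ω c : ℝ) (N : ℕ) (C lam : ℝ) : ℝ :=
  C * (3 / 2 + 2 * C * ((1 + N) / c + N + 2 * Ω / (Ω - 1)) +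
    4 * (C * (3 + 3 * (2 * C * ((1 + N) / c + N + 2 * Ω / (Ω - 1))) +
      (2 * C * ((1 + N) / c + N + 2 * Ω / (Ω - 1))) ^ 2) / 2) / (lam - 1) / 2)

/-- `F' = C_η + C_γK_Z`: the `μ`-source of the mode is bounded by `(F'/g₀²)χ_lg̊_l²`. [cite: BauerschmidtBrydgesSlade2015Flow, Lemma 2.3, (2.39)] -/
def modeMuSrcConst (Ω c : ℝ) (N : ℕ) (C lam : ℝ) : ℝ := etaTConst Ω c N C lam + gammaTConst Ω c N C lam * modeZConst Ω c N C

namespace CutoffQuadHyp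

variable {P : QuadFlowParams} {Ω : ℝ} {k : ℕ∞} {B c : ℝ} {N : ℕ} {C lam g₀ : ℝ}
  (h : CutoffQuadHyp P Ω k B c N C lam g₀)
include h

/-- `0 ≤ π_j ≤ (g̊_j/g̊₀)²` ((2.36): `ḡ_j' = O(ḡ_j²/ḡ₀²)`). [cite: BauerschmidtBrydgesSlade2015Flow, Lemma 2.3, (2.36) and Lemma 4.1(i), (4.6)] -/
theorem piG_mem (j : ℕ) : P.piG g₀ j ∈ Set.Icc (0 : ℝ) ((gbar P.β g₀ j / g₀) ^ 2) := by
  refine ⟨Finset.prod_nonneg fun i _ => (h.aCoef_mem i).1, ?_⟩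
  have := h.prod_aCoef_le 0 j
  simpa [QuadFlowParams.piG] using this

/-- Nonnegativity of the constants. [cite: BauerschmidtBrydgesSlade2015Flow, Lemma 4.1] -/
theorem modeConsts_nonneg : 0 ≤ xiTConst Ω c N C ∧ 0 ≤ modeZConst Ω c N C ∧ 0 ≤ etaTConst Ω c N C lam ∧
    0 ≤ gammaTConst Ω c N C lam ∧ 0 ≤ modeMuSrcConst Ω c N C lam := by
  have := h.C_nonneg; have := h.Z_nonneg; have := h.toCutoffGbarHyp.C20_nonneg; have := (h.abs_mubar_le_Mmu 0).1
  have h1 : 0 ≤ xiTConst Ω c N C := by unfold xiTConst; positivity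
  have h2 : 0 ≤ modeZConst Ω c N C := by unfold modeZConst; positivity
  have h3 : 0 ≤ etaTConst Ω c N C lam := by unfold etaTConst; positivity
  have h4 : 0 ≤ gammaTConst Ω c N C lam := by unfold gammaTConst; positivity
  exact ⟨h1, h2, h3, h4, by unfold modeMuSrcConst; positivity⟩

/-- The `z`-source of the mode: `|ξ̃_lπ_l| ≤ (C_ξ/g₀²)·χ_lg̊_l³`. [cite: BauerschmidtBrydgesSlade2015Flow, Lemma 2.3 (proof of (2.38)) and Lemma 4.1(ii)] -/
theorem abs_modeZ_src_le (l : ℕ) :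
    |-(P.xiT g₀ l * P.piG g₀ l)| ≤ xiTConst Ω c N C / g₀ ^ 2 * (cutoffWeight Ω k l * gbar P.β g₀ l ^ 3) := by
  obtain ⟨hp0, hp1⟩ := h.piG_mem l
  have hξ : |P.xiT g₀ l| ≤ xiTConst Ω c N C * (cutoffWeight Ω k l * gbar P.β g₀ l) := h.abs_xiT_le l
  have hg0 := h.g₀_pos; have hgl := (h.gbar_pos l).le; have hw := (h.weight_pos l).le
  have hCξ := h.modeConsts_nonneg.1
  rw [abs_neg, abs_mul, abs_of_nonneg hp0]
  calc |P.xiT g₀ l| * P.piG g₀ l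
      ≤ (xiTConst Ω c N C * (cutoffWeight Ω k l * gbar P.β g₀ l)) * (gbar P.β g₀ l / g₀) ^ 2 :=
        mul_le_mul hξ hp1 hp0 (by positivity)
    _ = _ := by rw [div_pow]; field_simp

/-- `|Zᵉ_j| ≤ (K_Z/g₀²)χ_jg̊_j²`. [cite: BauerschmidtBrydgesSlade2015Flow, Lemma 2.3, (2.38)] -/
theorem abs_modeZ_le (j : ℕ) :
    |P.modeZ g₀ j| ≤ modeZConst Ω c N C / g₀ ^ 2 * (cutoffWeight Ω k j * gbar P.β g₀ j ^ 2) := by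
  have hE : 0 ≤ xiTConst Ω c N C / g₀ ^ 2 := by have := h.modeConsts_nonneg.1; have := h.g₀_pos; positivity
  have := h.abs_bwdZ_le hE h.abs_modeZ_src_le j
  refine this.trans (le_of_eq ?_)
  unfold modeZConst; ring

/-- `Zᵉ_{j+1} = (1 - ζ_jg̊_j)Zᵉ_j - ξ̃_jπ_j`. [cite: BauerschmidtBrydgesSlade2015Flow, Lemma 2.3, (2.37) and Lemma 4.2] -/
theorem modeZ_succ (j : ℕ) : P.modeZ g₀ (j + 1) = P.czCoef g₀ j * P.modeZ g₀ j - P.xiT g₀ j * P.piG g₀ j := by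
  have := h.bwdZ_succ h.abs_modeZ_src_le j
  simp only [QuadFlowParams.modeZ, QuadFlowParams.czCoef]
  rw [this]; ring

/-- `Zᵉ_j → 0`. [cite: BauerschmidtBrydgesSlade2015Flow, Lemma 2.3 ("z̄_∞' = 0")] -/
theorem tendsto_modeZ_zero : Tendsto (P.modeZ g₀) atTop (𝓝 0) := by
  have hE : 0 ≤ xiTConst Ω c N C / g₀ ^ 2 := by have := h.modeConsts_nonneg.1; have := h.g₀_pos; positivity
  exact h.tendsto_bwdZ_zero hE h.abs_modeZ_src_le

/-- The `μ`-source of the mode: `|η̃_lπ_l + γ̃_lZᵉ_l| ≤ (F'/g₀²)·χ_lg̊_l²`.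
[cite: BauerschmidtBrydgesSlade2015Flow, Lemma 2.3 (proof of (2.40)) and Lemma 4.1(ii)] -/
theorem abs_modeMu_src_le (l : ℕ) :
    |P.etaT g₀ l * P.piG g₀ l + P.gammaT g₀ l * P.modeZ g₀ l| ≤
      modeMuSrcConst Ω c N C lam / g₀ ^ 2 * (cutoffWeight Ω k l * gbar P.β g₀ l ^ 2) := by
  have hη : |P.etaT g₀ l| ≤ etaTConst Ω c N C lam * cutoffWeight Ω k l := h.abs_etaT_le l
  have hγ : |P.gammaT g₀ l| ≤ gammaTConst Ω c N C lam * cutoffWeight Ω k l := h.abs_gammaT_le l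
  obtain ⟨hp0, hp1⟩ := h.piG_mem l
  have hZ := h.abs_modeZ_le l
  obtain ⟨-, hKZ0, hCη0, hCγ0, -⟩ := h.modeConsts_nonneg
  have hg0 := h.g₀_pos; have hgl := (h.gbar_pos l).le; have hw := (h.weight_pos l).le; have hw1 := h.weight_le_one l
  have t1 : |P.etaT g₀ l * P.piG g₀ l| ≤ etaTConst Ω c N C lam / g₀ ^ 2 * (cutoffWeight Ω k l * gbar P.β g₀ l ^ 2) := by
    rw [abs_mul, abs_of_nonneg hp0]
    calc |P.etaT g₀ l| * P.piG g₀ l ≤ (etaTConst Ω c N C lam * cutoffWeight Ω k l) * (gbar P.β g₀ l / g₀) ^ 2 :=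
          mul_le_mul hη hp1 hp0 (by positivity)
      _ = _ := by rw [div_pow]; field_simp
  have t2 : |P.gammaT g₀ l * P.modeZ g₀ l| ≤
      gammaTConst Ω c N C lam * modeZConst Ω c N C / g₀ ^ 2 * (cutoffWeight Ω k l * gbar P.β g₀ l ^ 2) := by
    rw [abs_mul]
    calc |P.gammaT g₀ l| * |P.modeZ g₀ l|
        ≤ (gammaTConst Ω c N C lam * cutoffWeight Ω k l) * (modeZConst Ω c N C / g₀ ^ 2 * (cutoffWeight Ω k l * gbar P.β g₀ l ^ 2)) :=
          mul_le_mul hγ hZ (abs_nonneg _) (by positivity)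
      _ = gammaTConst Ω c N C lam * modeZConst Ω c N C / g₀ ^ 2 * (cutoffWeight Ω k l * gbar P.β g₀ l ^ 2) * cutoffWeight Ω k l := by
          ring
      _ ≤ gammaTConst Ω c N C lam * modeZConst Ω c N C / g₀ ^ 2 * (cutoffWeight Ω k l * gbar P.β g₀ l ^ 2) * 1 := by gcongr
      _ = _ := mul_one _
  calc |P.etaT g₀ l * P.piG g₀ l + P.gammaT g₀ l * P.modeZ g₀ l|
      ≤ |P.etaT g₀ l * P.piG g₀ l| + |P.gammaT g₀ l * P.modeZ g₀ l| := abs_add_le _ _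
    _ ≤ _ := add_le_add t1 t2
    _ = _ := by unfold modeMuSrcConst; ring

end CutoffQuadHyp


/-! ### The `μ`-row of the mode, and the scaled mode `e ∈ ℓ^∞(ℝ³)` with `‖e‖ = O(1/(𝗁g₀²|log g₀|))` ((3.15)) -/

namespace QuadFlowParams

variable (P : QuadFlowParams) (g₀ : ℝ)

/-- The scaled homogeneous mode `e_j = (π_j/𝗐_{g,j}, Zᵉ_j/𝗐_{z,j}, Mᵉ_j/𝗐_{μ,j})`.
[cite: BauerschmidtBrydgesSlade2015Flow, Lemma 3.4, (3.15)] -/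
def modeV (Ω : ℝ) (k : ℕ∞) (hh : ℝ) (j : ℕ) : V3 :=
  ![P.piG g₀ j / P.wG g₀ hh j, P.modeZ g₀ j / P.wZ g₀ Ω k hh j, P.modeMu g₀ j / P.wZ g₀ Ω k hh j]

end QuadFlowParams

/-- `K_e = 2(1 + K_Z + 8F'/(λ-1))`: `‖e_j‖ ≤ K_e/(𝗁g₀²|log g₀|)`. [cite: BauerschmidtBrydgesSlade2015Flow, Lemma 3.4, (3.15)] -/
def modeVConst (Ω c : ℝ) (N : ℕ) (C lam : ℝ) : ℝ := 2 * (1 + modeZConst Ω c N C + 8 * modeMuSrcConst Ω c N C lam / (lam - 1))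

namespace CutoffQuadHyp

variable {P : QuadFlowParams} {Ω : ℝ} {k : ℕ∞} {B c : ℝ} {N : ℕ} {C lam g₀ : ℝ}
  (h : CutoffQuadHyp P Ω k B c N C lam g₀)
include h

/-- `|Mᵉ_j| ≤ (8F'/(g₀²(λ-1)))χ_jg̊_j²`. [cite: BauerschmidtBrydgesSlade2015Flow, Lemma 2.3, (2.40)] -/
theorem abs_modeMu_le (j : ℕ) :
    |P.modeMu g₀ j| ≤ 8 * (modeMuSrcConst Ω c N C lam / g₀ ^ 2) / (lam - 1) * (cutoffWeight Ω k j * gbar P.β g₀ j ^ 2) := by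
  have hF : 0 ≤ modeMuSrcConst Ω c N C lam / g₀ ^ 2 := by have := h.modeConsts_nonneg.2.2.2.2; have := h.g₀_pos; positivity
  exact h.abs_bwdMu_le hF h.abs_modeMu_src_le j

/-- `Mᵉ_{j+1} = λ̃_jMᵉ_j + η̃_jπ_j + γ̃_jZᵉ_j`. [cite: BauerschmidtBrydgesSlade2015Flow, Lemma 2.3, (2.39) and Lemma 4.2] -/
theorem modeMu_succ (j : ℕ) :
    P.modeMu g₀ (j + 1) = P.lamT g₀ j * P.modeMu g₀ j + (P.etaT g₀ j * P.piG g₀ j + P.gammaT g₀ j * P.modeZ g₀ j) := by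
  have hF : 0 ≤ modeMuSrcConst Ω c N C lam / g₀ ^ 2 := by have := h.modeConsts_nonneg.2.2.2.2; have := h.g₀_pos; positivity
  have := h.bwdMu_succ hF h.abs_modeMu_src_le j
  simp only [QuadFlowParams.modeMu]
  rw [this, P.lamT_eq]

/-- `Mᵉ_j → 0`. [cite: BauerschmidtBrydgesSlade2015Flow, Lemma 2.3 ("μ̄_∞' = 0")] -/
theorem tendsto_modeMu_zero : Tendsto (P.modeMu g₀) atTop (𝓝 0) := by
  have hwt : Tendsto (fun j => cutoffWeight Ω k j * gbar P.β g₀ j ^ 2) atTop (𝓝 0) := by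
    refine squeeze_zero (fun j => by have := (h.weight_pos j).le; positivity) (fun j => ?_)
      h.tendsto_weight_mul_gbar_zero
    have := (h.weight_pos j).le; have := (h.gbar_pos j).le; have := h.gbar_le_half j
    calc cutoffWeight Ω k j * gbar P.β g₀ j ^ 2 = cutoffWeight Ω k j * gbar P.β g₀ j * gbar P.β g₀ j := by ring
      _ ≤ cutoffWeight Ω k j * gbar P.β g₀ j * 1 := by gcongr; linarith
      _ = _ := mul_one _
  refine squeeze_zero_norm (fun j => (Real.norm_eq_abs _).trans_le (h.abs_modeMu_le j)) ?_
  simpa using hwt.const_mul _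

/-- `|log g̊_j| ≥ |log g₀|/2` (`g̊_j ≤ 2g₀ ≤ 1/2`). [cite: BauerschmidtBrydgesSlade2015Flow, Lemma 2.1(i)] -/
theorem abs_log_gbar_ge (j : ℕ) : |Real.log g₀| / 2 ≤ |Real.log (gbar P.β g₀ j)| := by
  have hg := h.gbar_pos j; have hg2 := h.gbar_le_two_mul_init j; have hg₀ := h.g₀_pos; have hle := h.g₀_le
  have h1 : Real.log (gbar P.β g₀ j) ≤ Real.log (2 * g₀) := Real.log_le_log hg hg2
  have h2 : Real.log (2 * g₀) = Real.log 2 + Real.log g₀ := by rw [Real.log_mul (by norm_num) hg₀.ne']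
  have h3 : Real.log g₀ ≤ Real.log (1 / 4) := Real.log_le_log hg₀ hle
  have h4 : Real.log (1 / 4 : ℝ) = -(2 * Real.log 2) := by
    rw [show (1 / 4 : ℝ) = (2 ^ 2)⁻¹ by norm_num, Real.log_inv, Real.log_pow]; ring
  have hl2 : 0 < Real.log 2 := Real.log_pos (by norm_num)
  have hneg : Real.log g₀ < 0 := by linarith
  rw [abs_of_neg hneg, abs_of_nonpos (by linarith)]
  linarith

/-- **[BBS-rg-flow, Lemma 3.4, (3.15)]** for the scaled mode: `‖e_j‖ ≤ K_e/(𝗁g₀²|log g₀|)` with `K_e`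
depending only on `(Ω, c, N, C, λ)` — the bound `‖D_{g₀}x̄‖_{X^𝗐} ≤ O(g̊₀⁻²|log g̊₀|⁻¹)` for the
`𝒱`-components. [cite: BauerschmidtBrydgesSlade2015Flow, Lemma 3.4, (3.15)] -/
theorem norm_modeV_le {hh : ℝ} (hh0 : 0 < hh) (j : ℕ) :
    ‖P.modeV g₀ Ω k hh j‖ ≤ modeVConst Ω c N C lam / (hh * g₀ ^ 2 * |Real.log g₀|) := by
  obtain ⟨-, hKZ0, -, -, hF0⟩ := h.modeConsts_nonneg
  have hg₀ := h.g₀_pos; have hgj := h.gbar_pos j; have hw := h.weight_pos j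
  have hlam := h.one_lt_lam
  have hL0 : 0 < |Real.log g₀| := by
    have : Real.log g₀ < 0 := Real.log_neg hg₀ (by linarith [h.g₀_le])
    exact abs_pos.2 this.ne
  have hLj := h.abs_log_gbar_ge j
  have hLjpos : 0 < |Real.log (gbar P.β g₀ j)| := lt_of_lt_of_le (by positivity) hLj
  have hG := h.wG_pos hh0 j; have hZw := h.wZ_pos hh0 j
  set X : ℝ := 2 / (hh * g₀ ^ 2 * |Real.log g₀|) with hX
  have hX0 : 0 ≤ X := by rw [hX]; positivity
  -- `1/(𝗁g₀²|log g̊_j|) ≤ X`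
  have hrec : 1 / (hh * g₀ ^ 2 * |Real.log (gbar P.β g₀ j)|) ≤ X := by
    rw [hX, div_le_div_iff₀ (by positivity) (by positivity)]
    have : 0 < hh * g₀ ^ 2 := by positivity
    nlinarith
  obtain ⟨hp0, hp1⟩ := h.piG_mem j
  have h8 : 0 ≤ 8 * modeMuSrcConst Ω c N C lam / (lam - 1) := div_nonneg (by positivity) (by linarith)
  -- coordinate `g`
  have e0 : |P.piG g₀ j / P.wG g₀ hh j| ≤ 1 * X := by
    rw [abs_div, abs_of_nonneg hp0, abs_of_pos hG, one_mul]
    refine le_trans ?_ hrec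
    rw [div_le_div_iff₀ hG (by positivity), QuadFlowParams.wG, one_mul]
    calc P.piG g₀ j * (hh * g₀ ^ 2 * |Real.log (gbar P.β g₀ j)|)
        ≤ (gbar P.β g₀ j / g₀) ^ 2 * (hh * g₀ ^ 2 * |Real.log (gbar P.β g₀ j)|) := by gcongr
      _ = hh * (gbar P.β g₀ j ^ 2 * |Real.log (gbar P.β g₀ j)|) := by rw [div_pow]; field_simp
  -- coordinate `z`
  have e1 : |P.modeZ g₀ j / P.wZ g₀ Ω k hh j| ≤ modeZConst Ω c N C * X := by
    rw [abs_div, abs_of_pos hZw, div_le_iff₀ hZw]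
    have hz := h.abs_modeZ_le j
    have step : modeZConst Ω c N C / g₀ ^ 2 * (cutoffWeight Ω k j * gbar P.β g₀ j ^ 2) =
        modeZConst Ω c N C * (1 / (hh * g₀ ^ 2 * |Real.log (gbar P.β g₀ j)|)) * P.wZ g₀ Ω k hh j := by
      rw [QuadFlowParams.wZ]; field_simp
    calc |P.modeZ g₀ j| ≤ modeZConst Ω c N C / g₀ ^ 2 * (cutoffWeight Ω k j * gbar P.β g₀ j ^ 2) := hz
      _ = modeZConst Ω c N C * (1 / (hh * g₀ ^ 2 * |Real.log (gbar P.β g₀ j)|)) * P.wZ g₀ Ω k hh j := step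
      _ ≤ modeZConst Ω c N C * X * P.wZ g₀ Ω k hh j := by gcongr
  -- coordinate `μ`
  have e2 : |P.modeMu g₀ j / P.wZ g₀ Ω k hh j| ≤ 8 * modeMuSrcConst Ω c N C lam / (lam - 1) * X := by
    rw [abs_div, abs_of_pos hZw, div_le_iff₀ hZw]
    have hm := h.abs_modeMu_le j
    have step : 8 * (modeMuSrcConst Ω c N C lam / g₀ ^ 2) / (lam - 1) * (cutoffWeight Ω k j * gbar P.β g₀ j ^ 2) =
        8 * modeMuSrcConst Ω c N C lam / (lam - 1) * (1 / (hh * g₀ ^ 2 * |Real.log (gbar P.β g₀ j)|)) * P.wZ g₀ Ω k hh j := by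
      rw [QuadFlowParams.wZ]
      have : lam - 1 ≠ 0 := by linarith
      field_simp
    calc |P.modeMu g₀ j| ≤ _ := hm
      _ = _ := step
      _ ≤ 8 * modeMuSrcConst Ω c N C lam / (lam - 1) * X * P.wZ g₀ Ω k hh j := by gcongr
  have key : ∀ t : ℝ, 0 ≤ t → t ≤ 1 + modeZConst Ω c N C + 8 * modeMuSrcConst Ω c N C lam / (lam - 1) →
      t * X ≤ modeVConst Ω c N C lam / (hh * g₀ ^ 2 * |Real.log g₀|) := by
    intro t ht0 ht
    calc t * X ≤ (1 + modeZConst Ω c N C + 8 * modeMuSrcConst Ω c N C lam / (lam - 1)) * X := by gcongr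
      _ = modeVConst Ω c N C lam / (hh * g₀ ^ 2 * |Real.log g₀|) := by rw [hX, modeVConst]; ring
  have hbig : 0 ≤ 1 + modeZConst Ω c N C + 8 * modeMuSrcConst Ω c N C lam / (lam - 1) := by positivity
  refine norm_V3_le ((mul_nonneg hbig hX0).trans (key _ hbig le_rfl)) ?_ ?_ ?_
  · exact e0.trans (key 1 zero_le_one (by linarith))
  · exact e1.trans (key _ hKZ0 (by linarith))
  · exact e2.trans (key _ h8 (by linarith))

end CutoffQuadHyp

end CTWSAW

end Literature.Barriers.CriticalPhenomena
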